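import Summits.Ventures.PercRepro.MSRMStarConjV

/-!
# V-SHARP: the block structure of the residue instances of Conjecture V

Dossier proofs/MINE1-theoremS.md, Addendum 4 (the structure clauses) and Addendum 66 (this
module). Conjecture V (`conjV`, MSRMStarConjV.lean) says that an instance — an MS-excess-one family
`F` disjoint from its complement family, with a near-member `u` for a sign pattern and with neither
`F ∪ {u}` nor `F ∪ {uᶜ}` tight — is a block family (`F \\ F = insert ∅ F`) or the mirror of one.
The SHARP form of Addendum 4 reads the whole structure off that equation:

* `L := insert ∅ F` is tight and contains `∅`, so by Theorem S (the convexity of tight families on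
  twin-closed sets) it is a **class-down-set**: every twin-closed subset of a member is `∅` or a
  member (`BlockStructure.down`);
* `u` is twin-closed for `F` (`BlockStructure.twinClosed_u`), `u ≠ ∅`, `u ≠ univ`;
* `L` is **closed under `s ↦ u \ s` for every member meeting `u`** and under `s ↦ uᶜ \ s` for
  every member meeting `uᶜ` (`closure_u`, `closure_compl`): the face `s ∩ u` is a member, it is not
  agreement-signable (its cell `uᶜ` is neither `∅` nor a member), hence it is disagreement-signable;
* consequently **the signs are forced by position**: a member is agreement-signable iff it is not
  inside `u`, and disagreement-signable iff it is not inside `uᶜ` (`cells_u_iff`, `cells_compl_iff`);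
  so `C_o = {s ⊆ u}`, `A_o = {s ⊆ uᶜ}` and `B_o` = the members meeting both sides.

`vsharp` gives the dichotomy `BlockStructure F u ∨ BlockStructure (compls F) u` for every instance
of `ConjV`, and `Residue.blockStructure` for the lane's residue instances.
-/

namespace PercRepro.MSTight

open Finset
open scoped FinsetFamily

variable {α : Type*} [DecidableEq α] [Fintype α]

/-- **The block structure** of an instance `(F, u)` (V-SHARP, Addendum 4): `F \\ F = F ∪ {∅}`,
`F ∪ {∅}` a tight class-down-set, `u` a twin-closed set with `u, uᶜ ∉ F ∪ {∅}`, the closure of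
`F ∪ {∅}` under `s ↦ u \ s` (members meeting `u`) and `s ↦ uᶜ \ s` (members meeting `uᶜ`), and
the signs forced by position. -/
structure BlockStructure (F : Finset (Finset α)) (u : Finset α) : Prop where
  /-- every difference is a member or empty -/
  diffs_eq : F \\ F = insert ∅ F
  /-- `∅ ∉ F` -/
  empty_notMem : (∅ : Finset α) ∉ F
  /-- `F ∪ {∅}` is tight -/
  tight : Tight (insert ∅ F)
  /-- `u ≠ ∅` -/
  u_ne_empty : u ≠ ∅
  /-- `u ≠ univ` -/
  u_ne_univ : u ≠ univ
  /-- `u ∉ F` -/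
  u_notMem : u ∉ F
  /-- `uᶜ ∉ F` -/
  compl_u_notMem : univ \ u ∉ F
  /-- `u` is twin-closed for `F` -/
  twinClosed_u : TwinClosed F u
  /-- `F ∪ {∅}` is a class-down-set: a twin-closed subset of a member is `∅` or a member -/
  down : ∀ t ∈ F, ∀ z, z ⊆ t → TwinClosed F z → z ∈ insert ∅ F
  /-- closure under `s ↦ u \ s` for members meeting `u` -/
  closure_u : ∀ t ∈ F, (t ∩ u).Nonempty → u \ t ∈ insert ∅ F
  /-- closure under `s ↦ uᶜ \ s` for members meeting `uᶜ` -/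
  closure_compl : ∀ t ∈ F, (t \ u).Nonempty → (univ \ u) \ t ∈ insert ∅ F
  /-- a member is agreement-signable for `u` iff it is not inside `u` -/
  cells_u_iff : ∀ t ∈ F, Cells (F \\ F) t u ↔ ¬ t ⊆ u
  /-- a member is disagreement-signable for `u` iff it is not inside `uᶜ` -/
  cells_compl_iff : ∀ t ∈ F, Cells (F \\ F) t (univ \ u) ↔ ¬ t ⊆ univ \ u

namespace BlockStructure

variable {F : Finset (Finset α)} {u : Finset α}

/-- `u` is not a difference. -/
theorem u_notMem_diffs (h : BlockStructure F u) : u ∉ F \\ F := by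
  rw [h.diffs_eq, mem_insert, not_or]
  exact ⟨h.u_ne_empty, h.u_notMem⟩

/-- `uᶜ` is not a difference. -/
theorem compl_u_notMem_diffs (h : BlockStructure F u) : univ \ u ∉ F \\ F := by
  rw [h.diffs_eq, mem_insert, not_or]
  refine ⟨fun he => h.u_ne_univ ?_, h.compl_u_notMem⟩
  rw [sdiff_eq_empty_iff_subset] at he
  exact (subset_univ u).antisymm he

/-- The members inside `u` are exactly the members that are not agreement-signable
(the class `C_o`). -/
theorem subset_u_iff (h : BlockStructure F u) {t : Finset α} (ht : t ∈ F) :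
    t ⊆ u ↔ ¬ Cells (F \\ F) t u := by
  rw [h.cells_u_iff t ht, not_not]

/-- The members inside `uᶜ` are exactly the members that are not disagreement-signable
(the class `A_o`). -/
theorem subset_compl_iff (h : BlockStructure F u) {t : Finset α} (ht : t ∈ F) :
    t ⊆ univ \ u ↔ ¬ Cells (F \\ F) t (univ \ u) := by
  rw [h.cells_compl_iff t ht, not_not]

/-- The members meeting both sides (the class `B_o`) form an up-set inside `F`. -/
theorem both_of_subset (h : BlockStructure F u) {t s : Finset α} (ht : t ∈ F) (hs : s ∈ F)
    (hts : t ⊆ s) (h1 : Cells (F \\ F) t u) (h2 : Cells (F \\ F) t (univ \ u)) :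
    Cells (F \\ F) s u ∧ Cells (F \\ F) s (univ \ u) := by
  rw [h.cells_u_iff t ht] at h1
  rw [h.cells_compl_iff t ht] at h2
  rw [h.cells_u_iff s hs, h.cells_compl_iff s hs]
  exact ⟨fun hsu => h1 (hts.trans hsu), fun hsu => h2 (hts.trans hsu)⟩

end BlockStructure

section Aux

variable {F : Finset (Finset α)}

omit [Fintype α] in
/-- Twinness for `F ∪ {∅}` is twinness for `F`. -/
theorem twin_insert_empty_iff {a b : α} : Twin (insert ∅ F) a b ↔ Twin F a b := by
  constructor
  · intro h t ht
    exact h t (mem_insert_of_mem ht)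
  · intro h t ht
    rcases mem_insert.1 ht with rfl | ht
    · simp
    · exact h t ht

omit [Fintype α] in
/-- Twin-closedness for `F ∪ {∅}` is twin-closedness for `F`. -/
theorem twinClosed_insert_empty_iff {z : Finset α} :
    TwinClosed (insert ∅ F) z ↔ TwinClosed F z := by
  constructor
  · intro h a b hab ha
    exact h a b (twin_insert_empty_iff.2 hab) ha
  · intro h a b hab ha
    exact h a b (twin_insert_empty_iff.1 hab) ha

omit [Fintype α] in
/-- If every difference of `F` is a member or empty, then `F ∪ {∅}` is its own difference
family. -/
theorem diffs_insert_empty_eq (h : F \\ F = insert ∅ F) :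
    insert ∅ F \\ insert ∅ F = insert ∅ F := by
  ext z
  constructor
  · intro hz
    obtain ⟨a, ha, b, hb, rfl⟩ := mem_diffs.1 hz
    rcases mem_insert.1 ha with rfl | ha
    · simp
    rcases mem_insert.1 hb with rfl | hb
    · rw [sdiff_empty]
      exact mem_insert_of_mem ha
    · rw [← h]
      exact mem_diffs.2 ⟨a, ha, b, hb, rfl⟩
  · intro hz
    rcases mem_insert.1 hz with rfl | hz
    · exact mem_diffs.2 ⟨∅, mem_insert_self _ _, ∅, mem_insert_self _ _, sdiff_empty⟩
    · exact mem_diffs.2 ⟨z, mem_insert_of_mem hz, ∅, mem_insert_self _ _, sdiff_empty⟩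

end Aux

section Main

variable {F : Finset (Finset α)} {u : Finset α}

/-- **The block structure from the block equation.** An instance of Conjecture V (stated with
«every member is agreement- or disagreement-signable») whose differences are its members and `∅`
has the full block structure of V-SHARP. -/
theorem blockStructure_of_diffs_eq (hex : (F \\ F).card = F.card + 1)
    (hu : u ∉ F) (huc : univ \ u ∉ F)
    (hsig : ∀ t ∈ F, Cells (F \\ F) t u ∨ Cells (F \\ F) t (univ \ u))
    (hnt : ¬ Tight (insert u F)) (hntc : ¬ Tight (insert (univ \ u) F))
    (h : F \\ F = insert ∅ F) : BlockStructure F u := by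
  -- `∅ ∉ F`
  have hempty : (∅ : Finset α) ∉ F := by
    intro he
    rw [h, insert_eq_of_mem he] at hex
    omega
  -- `F ∪ {∅}` is tight
  have htight : Tight (insert ∅ F) := by
    unfold Tight
    rw [diffs_insert_empty_eq h]
  -- `u ≠ ∅`, `u ≠ univ`
  have hune : u ≠ ∅ := by
    rintro rfl
    exact hnt htight
  have hunu : u ≠ univ := by
    rintro rfl
    rw [sdiff_self, bot_eq_empty] at hntc
    exact hntc htight
  -- `F` is nonempty
  have hFne : F.Nonempty := by
    by_contra hne
    rw [not_nonempty_iff_eq_empty] at hne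
    subst hne
    simp at hex
  -- `u` is twin-closed
  have hu_tc : TwinClosed F u := by
    obtain ⟨t, ht⟩ := hFne
    rcases hsig t ht with hc | hc
    · exact twinClosed_of_cells ht hc
    · have h2 := (twinClosed_univ F).sdiff (twinClosed_of_cells ht hc)
      rwa [compl_compl_eq] at h2
  have huc_tc : TwinClosed F (univ \ u) := (twinClosed_univ F).sdiff hu_tc
  -- the class-down-set property, from the convexity of the tight family `F ∪ {∅}`
  have hdown : ∀ t ∈ F, ∀ z, z ⊆ t → TwinClosed F z → z ∈ insert ∅ F := by
    intro t ht z hzt hz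
    exact mem_of_subset_of_subset_of_twinClosed_of_tight htight (mem_insert_self _ _)
      (mem_insert_of_mem ht) (empty_subset z) hzt (twinClosed_insert_empty_iff.2 hz)
  -- `uᶜ ∉ F ∪ {∅}` and `u ∉ F ∪ {∅}`
  have hucL : univ \ u ∉ insert ∅ F := by
    rw [mem_insert, not_or]
    refine ⟨fun he => hunu ?_, huc⟩
    rw [sdiff_eq_empty_iff_subset] at he
    exact (subset_univ u).antisymm he
  have huL : u ∉ insert ∅ F := by
    rw [mem_insert, not_or]
    exact ⟨hune, hu⟩
  -- closure under `s ↦ u \ s`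
  have hclu : ∀ t ∈ F, (t ∩ u).Nonempty → u \ t ∈ insert ∅ F := by
    intro t ht hne
    have hs : t ∩ u ∈ insert ∅ F :=
      hdown t ht _ inter_subset_left ((twinClosed_of_mem ht).inter hu_tc)
    rcases mem_insert.1 hs with he | hs
    · rw [he] at hne
      exact absurd hne not_nonempty_empty
    rcases hsig _ hs with hc | hc
    · exfalso
      have e : (univ \ (t ∩ u)) ∩ (univ \ u) = univ \ u := by
        ext x; simp only [mem_inter, mem_sdiff, mem_univ, true_and]; tauto
      rw [Cells, e, h] at hc
      exact hucL hc.2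
    · have e : (univ \ (t ∩ u)) ∩ (univ \ (univ \ u)) = u \ t := by
        ext x; simp only [mem_inter, mem_sdiff, mem_univ, true_and]; tauto
      rw [Cells, e, h] at hc
      exact hc.2
  -- closure under `s ↦ uᶜ \ s`
  have hclc : ∀ t ∈ F, (t \ u).Nonempty → (univ \ u) \ t ∈ insert ∅ F := by
    intro t ht hne
    have hs : t \ u ∈ insert ∅ F :=
      hdown t ht _ sdiff_subset ((twinClosed_of_mem ht).sdiff hu_tc)
    rcases mem_insert.1 hs with he | hs
    · rw [he] at hne
      exact absurd hne not_nonempty_empty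
    rcases hsig _ hs with hc | hc
    · have e : (univ \ (t \ u)) ∩ (univ \ u) = (univ \ u) \ t := by
        ext x; simp only [mem_inter, mem_sdiff, mem_univ, true_and]; tauto
      rw [Cells, e, h] at hc
      exact hc.2
    · exfalso
      have e : (univ \ (t \ u)) ∩ (univ \ (univ \ u)) = u := by
        ext x; simp only [mem_inter, mem_sdiff, mem_univ, true_and]; tauto
      rw [Cells, e, h] at hc
      exact huL hc.2
  refine ⟨h, hempty, htight, hune, hunu, hu, huc, hu_tc, hdown, hclu, hclc, ?_, ?_⟩
  · -- agreement-signable iff not inside `u`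
    intro t ht
    constructor
    · intro hc htu
      have e : (univ \ t) ∩ (univ \ u) = univ \ u := by
        ext x; simp only [mem_inter, mem_sdiff, mem_univ, true_and]
        exact ⟨fun h' => h'.2, fun h' => ⟨fun hx => h' (htu hx), h'⟩⟩
      rw [Cells, e, h] at hc
      exact hucL hc.2
    · intro htu
      have hne : (t \ u).Nonempty := by
        rw [nonempty_iff_ne_empty, Ne, sdiff_eq_empty_iff_subset]
        exact htu
      have e : (univ \ t) ∩ (univ \ u) = (univ \ u) \ t := by
        ext x; simp only [mem_inter, mem_sdiff, mem_univ, true_and]; tauto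
      refine ⟨?_, ?_⟩
      · rw [h]
        exact hdown t ht _ inter_subset_left ((twinClosed_of_mem ht).inter hu_tc)
      · rw [e, h]
        exact hclc t ht hne
  · -- disagreement-signable iff not inside `uᶜ`
    intro t ht
    constructor
    · intro hc htu
      have e : (univ \ t) ∩ (univ \ (univ \ u)) = u := by
        ext x; simp only [mem_inter, mem_sdiff, mem_univ, true_and, not_not]
        constructor
        · rintro ⟨-, hx⟩; exact hx
        · intro hx
          exact ⟨fun hxt => (mem_sdiff.1 (htu hxt)).2 hx, hx⟩
      rw [Cells, e, h] at hc
      exact huL hc.2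
    · intro htu
      have hne : (t ∩ u).Nonempty := by
        rw [nonempty_iff_ne_empty]
        intro he
        apply htu
        intro x hx
        rw [mem_sdiff]
        refine ⟨mem_univ x, fun hxu => ?_⟩
        have : x ∈ t ∩ u := mem_inter.2 ⟨hx, hxu⟩
        rw [he] at this
        exact notMem_empty x this
      have e : (univ \ t) ∩ (univ \ (univ \ u)) = u \ t := by
        ext x; simp only [mem_inter, mem_sdiff, mem_univ, true_and]; tauto
      refine ⟨?_, ?_⟩
      · rw [h]
        exact hdown t ht _ inter_subset_left ((twinClosed_of_mem ht).inter huc_tc)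
      · rw [e, h]
        exact hclu t ht hne

/-- The signable-member hypothesis of an instance, transported to the complement family. -/
theorem sig_compls (hsig : ∀ t ∈ F, Cells (F \\ F) t u ∨ Cells (F \\ F) t (univ \ u)) :
    ∀ t ∈ compls F, Cells (compls F \\ compls F) t u ∨
      Cells (compls F \\ compls F) t (univ \ u) := by
  intro t ht
  rw [mem_compls] at ht
  rw [diffs_compls]
  have := hsig _ ht
  rw [cells_compl_left, cells_compl_left, compl_compl_eq] at this
  exact this.symm

/-- **V-SHARP.** Every instance of Conjecture V has the block structure, or its complement family
has it. -/
theorem vsharp (hval : Disjoint F (compls F)) (hex : (F \\ F).card = F.card + 1)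
    (hu : u ∉ F) (huc : univ \ u ∉ F)
    (hsig : ∀ t ∈ F, Cells (F \\ F) t u ∨ Cells (F \\ F) t (univ \ u))
    (hnt : ¬ Tight (insert u F)) (hntc : ¬ Tight (insert (univ \ u) F)) :
    BlockStructure F u ∨ BlockStructure (compls F) u := by
  classical
  -- the sign pattern of the instance
  let σ : Finset α → Bool := fun t => decide (Cells (F \\ F) t u)
  have hcells : ∀ t ∈ F, Cells (F \\ F) t (if σ t = true then u else univ \ u) := by
    intro t ht
    by_cases hc : Cells (F \\ F) t u
    · have hσ : σ t = true := decide_eq_true hc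
      rw [if_pos hσ]; exact hc
    · have hσ : σ t ≠ true := fun h' => hc (of_decide_eq_true h')
      rw [if_neg hσ]
      exact (hsig t ht).resolve_left hc
  rcases conjV α F σ u hval hex hu huc hcells hnt hntc with h | h
  · exact Or.inl (blockStructure_of_diffs_eq hex hu huc hsig hnt hntc h)
  · right
    have hex' : (compls F \\ compls F).card = (compls F).card + 1 := by
      rw [diffs_compls, card_compls]; exact hex
    have hu' : u ∉ compls F := by
      rw [mem_compls]; exact huc
    have huc' : univ \ u ∉ compls F := by
      rw [mem_compls, compl_compl_eq]; exact hu
    have hnt' : ¬ Tight (insert u (compls F)) := by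
      have e : insert u (compls F) = compls (insert (univ \ u) F) := by
        rw [compls_insert, compl_compl_eq]
      rw [e, tight_compls_iff]
      exact hntc
    have hntc' : ¬ Tight (insert (univ \ u) (compls F)) := by
      rw [← compls_insert, tight_compls_iff]
      exact hnt
    have h' : compls F \\ compls F = insert ∅ (compls F) := by
      rw [diffs_compls]; exact h
    exact blockStructure_of_diffs_eq hex' hu' huc' (sig_compls hsig) hnt' hntc' h'

/-- **V-SHARP for residue instances.** -/
theorem blockStructure_of_residue (h : Residue F u) :
    BlockStructure F u ∨ BlockStructure (compls F) u :=
  vsharp (Finset.disjoint_left.2 fun t ht ht' => h.hvalid t ht (mem_compls.1 ht')) h.hexc h.hu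
    h.hu' h.hsig h.hnt h.hnt'

end Main

end PercRepro.MSTight
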